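import Summits.QuantumFields.YangMills.Theorems.LuscherReductionTwistedTraceScalingBODoor
import Summits.QuantumFields.YangMills.Theorems.TwistedTraceScaling.Negative.StiffCaptureNecessity
import HarnessLib

/-!
# THE (B-OD) DOOR, PACKED: from the quasimode bound to the `hOD` currency `b·√‖boFun φ Ω‖²_w·√‖g‖²_w`
# (lane A of S-BASE, crux `TwistedTraceScaling` stmt-QuantumFields-20203, C4-CORE, the (OD) pen; design note `pub/ym-fleet/ym-luscher-20007-p1/COARSE-DESIGN.md` §26.7)

`…BODoor.tubeCross_boFun_le_of_quasimode` bounds the off-diagonal tube form by `η·∫_{u'} A'(u')·B(u')`, `A'(u') = ∫_u |φ|k(u',u)`, `B(u') = ∫_{v'} |g|·Ω·w`.  Two weighted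
Cauchy–Schwarz inequalities (`R40.sq_integral_mul_le_of_support`, fibre and slow), the fibre-mass sandwich `γ₋ ≤ fibreMass ≤ γ₊` ((B-N) brick), the disintegration of `‖g‖²_w` over
the tube and `‖boFun φ Ω‖²_w = ∫ φ²·fibreMass` (`tubeNormSq_boFun`), and an `L²` bound `Λ` for the slow kernel `k` acting on `|φ|` give
★★★ `tubeCross_boFun_le_hOD_of_quasimode`: `|tubeCross β g (boFun φ Ω)| ≤ η·Λ·√(γ₊/γ₋)·√(tubeNormSq w (boFun φ Ω))·√(tubeNormSq w g)` — the shape of `RecordAnalyticInput.hOD`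
(second conjunct; the first follows by the symmetry of `K̃`) with `b·σλ₀ = ηΛ√(γ₊/γ₋)`.
HONEST FRAMING: a reduction only; the quasimode bound `η`, the slow bound `Λ` and the fibre-mass sandwich are the (OD) pen's inputs; C4-CORE OPEN; stub of a child of the
CONDITIONAL route R2b1; not infinite volume, not a gap, not Clay.
-/

set_option autoImplicit false

noncomputable section

open MeasureTheory Filter Topology Real
open scoped BigOperators
open Literature.MathematicalPhysics.QuantumFieldTheory
open Literature.MathematicalPhysics.QuantumLattice

namespace Summit.QuantumFields.YangMills.Theorems.FemtoTransferGap.TwoLattice.ConstTube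

open Summit.QuantumFields.YangMills.Theorems.FemtoTransferGap
open Summit.QuantumFields.YangMills.Theorems.FemtoTransferGap.TwoLattice
open Summit.QuantumFields.YangMills.Theorems.FemtoTransferGap.TwoLattice.Avg
open Summit.QuantumFields.YangMills.Theorems.FemtoTransferGap.TwoLattice.Stiff (LinkSpace)
open Summit.QuantumFields.YangMills.Theorems.TwistedTraceScaling.Negative (R40.sq_integral_mul_le_of_support)

variable {L : ℕ} [NeZero L]

/-! ## §1 The weighted norm of a tube-supported function, disintegrated -/

/-- `‖g‖²_w = ∫_{u'} ∫_{v'} g(oT u' v')²·w(oT u' v') dπ(v') du'` for `g` supported in the tube. [folklore] -/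
theorem tubeNormSq_eq_integral_fibre {w : GaugeConfig 3 L SU2 → ℝ} (hwm : Measurable w) {Cw : ℝ} (hCw : ∀ U, |w U| ≤ Cw) {g : GaugeConfig 3 L SU2 → ℝ}
    (hgm : Measurable g) {Cg : ℝ} (hCg : ∀ U, |g U| ≤ Cg) (hgt : ∀ U, g U ≠ 0 → U ∈ orthoTubeSet L) :
    tubeNormSq w g = ∫ u', (∫ v', g (orthoTube L u' v') ^ 2 * w (orthoTube L u' v') ∂orthoTransverse L) ∂configMeasure SU2 1 := by
  have hCg0 : 0 ≤ Cg := (abs_nonneg _).trans (hCg 1)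
  have hg2m : Measurable fun U => g U ^ 2 := hgm.pow_const 2
  have hg2b : ∀ U, |g U ^ 2| ≤ Cg ^ 2 := fun U => by rw [abs_pow]; exact pow_le_pow_left₀ (abs_nonneg _) (hCg U) 2
  have hg2t : ∀ U, g U ^ 2 ≠ 0 → U ∈ orthoTubeSet L := fun U h => hgt U (by intro h0; apply h; rw [h0]; ring)
  unfold tubeNormSq
  have e : (fun U => g U ^ 2 * w U) = fun U => boFun L (fun _ => (1 : ℝ)) (fun _ => (1 : ℝ)) U * w U * g U ^ 2 := by
    funext U; rw [mul_boFun_one_one_of_support hg2t w U]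
  rw [e, integral_boFun_mul_eq (φ := fun _ => (1 : ℝ)) measurable_const (Cφ := 1) (fun _ => by rw [abs_one]) (Ω := fun _ => (1 : ℝ)) measurable_const (CΩ := 1)
    (fun _ => by rw [abs_one]) hwm hCw hg2m hg2b]
  refine integral_congr_ae (ae_of_all _ fun u' => ?_)
  dsimp only
  unfold fibreInner
  rw [one_mul]
  exact integral_congr_ae (ae_of_all _ fun v' => by dsimp only; ring)

/-! ## §2 ★★★ The packed door -/

/-- ★★★ **THE (B-OD) DOOR IN `hOD` CURRENCY.**  Under the hypotheses of `tubeCross_boFun_le_of_quasimode` plus: the fibre-mass sandwich `fibreMass w Ω ≤ γ₊` everywhere and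
`γ₋ ≤ fibreMass w Ω` on `supp φ` (`γ₋ > 0`), and the `L²` bound `∫_{u'}(∫_u |φ|k(u',u))² ≤ Λ²∫φ²` for the slow kernel:
`|tubeCross β g (boFun φ Ω)| ≤ ηΛ√(γ₊/γ₋)·√(tubeNormSq w (boFun φ Ω))·√(tubeNormSq w g)`. [cite: Luscher1983, §3] [cite: SjostrandZworski2007, §2] -/
theorem tubeCross_boFun_le_hOD_of_quasimode (β : ℝ) {Ω : LinkSpace L → ℝ} (hΩm : Measurable Ω) {CΩ : ℝ} (hCΩ : ∀ x, |Ω x| ≤ CΩ) (hΩ0 : ∀ x, 0 ≤ Ω x)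
    {w : GaugeConfig 3 L SU2 → ℝ} (hwm : Measurable w) {Cw : ℝ} (hCw : ∀ U, |w U| ≤ Cw) (hw0 : ∀ U, 0 ≤ w U)
    {φ : GaugeConfig 3 1 SU2 → ℝ} (hφm : Measurable φ) {Cφ : ℝ} (hCφ : ∀ u, |φ u| ≤ Cφ)
    {g : GaugeConfig 3 L SU2 → ℝ} (hgm : Measurable g) {Cg : ℝ} (hCg : ∀ U, |g U| ≤ Cg) (hgt : ∀ U, g U ≠ 0 → U ∈ orthoTubeSet L)
    (horth : ∀ u', fibreInner L w Ω g u' = 0)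
    {k : GaugeConfig 3 1 SU2 → GaugeConfig 3 1 SU2 → ℝ} (hkm : Measurable (Function.uncurry k)) {Ck : ℝ} (hCk : ∀ u' u, |k u' u| ≤ Ck) (hk0 : ∀ u' u, 0 ≤ k u' u)
    {η : ℝ} (hη : 0 ≤ η)
    (hQ : ∀ u, φ u ≠ 0 → ∀ (u' : GaugeConfig 3 1 SU2) (v' : Edge 3 L → Fin 3 → ℝ),
      |(∫ v, avgKernel β (orthoTube L u' v') (orthoTube L u v) * Ω (linkEmbed L v) ∂orthoTransverse L) - k u' u * (Ω (linkEmbed L v') * w (orthoTube L u' v'))| ≤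
        η * (k u' u * (Ω (linkEmbed L v') * w (orthoTube L u' v'))))
    {γp γm Λ : ℝ} (hγm : 0 < γm) (hNp : ∀ u', fibreMass L w Ω u' ≤ γp) (hNm : ∀ u, φ u ≠ 0 → γm ≤ fibreMass L w Ω u) (hΛ : 0 ≤ Λ)
    (hkop : ∫ u', (∫ u, |φ u| * k u' u ∂configMeasure SU2 1) ^ 2 ∂configMeasure SU2 1 ≤ Λ ^ 2 * ∫ u, φ u ^ 2 ∂configMeasure SU2 1) :
    |tubeCross β g (boFun L φ Ω)| ≤ η * Λ * Real.sqrt (γp / γm) * Real.sqrt (tubeNormSq w (boFun L φ Ω)) * Real.sqrt (tubeNormSq w g) := by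
  haveI := isFiniteMeasure_orthoTransverse L
  have hCφ0 : 0 ≤ Cφ := (abs_nonneg _).trans (hCφ 1)
  have hCΩ0 : 0 ≤ CΩ := (abs_nonneg _).trans (hCΩ 0)
  have hCg0 : 0 ≤ Cg := (abs_nonneg _).trans (hCg 1)
  have hCw0 : 0 ≤ Cw := (abs_nonneg _).trans (hCw 1)
  have hCk0 : 0 ≤ Ck := (abs_nonneg _).trans (hCk 1 1)
  set P : ℝ := (orthoTransverse L).real Set.univ with hPdef
  have hP0 : 0 ≤ P := measureReal_nonneg
  have hγp : 0 ≤ γp := le_trans (integral_nonneg fun v => mul_nonneg (sq_nonneg _) (hw0 _)) (hNp 1)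
  -- the door
  have hdoor := tubeCross_boFun_le_of_quasimode β hΩm hCΩ hΩ0 hwm hCw hw0 hφm hCφ hgm hCg hgt horth hkm hCk hk0 hη hQ
  set A' : GaugeConfig 3 1 SU2 → ℝ := fun u' => ∫ u, |φ u| * k u' u ∂configMeasure SU2 1 with hA'def
  set B : GaugeConfig 3 1 SU2 → ℝ := fun u' => ∫ v', |g (orthoTube L u' v')| * (Ω (linkEmbed L v') * w (orthoTube L u' v')) ∂orthoTransverse L with hBdef
  set N2 : GaugeConfig 3 1 SU2 → ℝ := fun u' => ∫ v', g (orthoTube L u' v') ^ 2 * w (orthoTube L u' v') ∂orthoTransverse L with hN2def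
  have hk_meas : ∀ u', Measurable fun u => k u' u := fun u' => hkm.comp (measurable_const.prodMk measurable_id)
  have hA'0 : ∀ u', 0 ≤ A' u' := fun u' => integral_nonneg fun u => mul_nonneg (abs_nonneg _) (hk0 _ _)
  have hN20 : ∀ u', 0 ≤ N2 u' := fun u' => integral_nonneg fun v' => mul_nonneg (sq_nonneg _) (hw0 _)
  have hB0 : ∀ u', 0 ≤ B u' := fun u' => integral_nonneg fun v' => mul_nonneg (abs_nonneg _) (mul_nonneg (hΩ0 _) (hw0 _))
  -- Step 1: fibre Cauchy–Schwarz `B(u')² ≤ fibreMass(u')·N2(u') ≤ γp·N2(u')`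
  have hBsq : ∀ u', B u' ^ 2 ≤ γp * N2 u' := by
    intro u'
    have hcs := R40.sq_integral_mul_le_of_support (orthoTransverse L) (p := fun v' => Ω (linkEmbed L v')) (q := fun v' => |g (orthoTube L u' v')|)
      (ω := fun v' => w (orthoTube L u' v')) (χ := fun _ => (1 : ℝ)) (hΩm.comp (measurable_linkEmbed L)) ((hgm.comp (measurable_orthoTube_right u')).abs)
      (hwm.comp (measurable_orthoTube_right u')) measurable_const (fun v' => hCΩ _) (fun v' => by rw [abs_abs]; exact hCg _) (fun v' => hCw _) (fun v' => hw0 _)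
      (fun _ => Or.inr rfl) (fun _ _ => rfl)
    have eB : B u' = ∫ v', |g (orthoTube L u' v')| * Ω (linkEmbed L v') * w (orthoTube L u' v') ∂orthoTransverse L := by
      rw [hBdef]; exact integral_congr_ae (ae_of_all _ fun v' => by dsimp only; ring)
    have eM : fibreMass L w Ω u' = ∫ v', Ω (linkEmbed L v') ^ 2 * w (orthoTube L u' v') ∂orthoTransverse L := rfl
    have eN : N2 u' = ∫ v', (1 : ℝ) * |g (orthoTube L u' v')| ^ 2 * w (orthoTube L u' v') ∂orthoTransverse L := by
      rw [hN2def]; exact integral_congr_ae (ae_of_all _ fun v' => by dsimp only; rw [sq_abs]; ring)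
    rw [eB, eN]
    refine hcs.trans ?_
    rw [← eM]
    have hN' : 0 ≤ ∫ v', (1 : ℝ) * |g (orthoTube L u' v')| ^ 2 * w (orthoTube L u' v') ∂orthoTransverse L :=
      integral_nonneg fun v' => by have := hw0 (orthoTube L u' v'); positivity
    exact mul_le_mul_of_nonneg_right (hNp u') hN'
  have hBle : ∀ u', B u' ≤ Real.sqrt γp * Real.sqrt (N2 u') := fun u' => by
    have h := Real.abs_le_sqrt (hBsq u')
    rwa [abs_of_nonneg (hB0 u'), Real.sqrt_mul hγp] at h
  -- Step 2: `∫ A'B ≤ √γp ∫ A'√N2`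
  have hA'm : Measurable A' := by
    have hJ : Measurable fun p : GaugeConfig 3 1 SU2 × GaugeConfig 3 1 SU2 => |φ p.2| * k p.1 p.2 := (hφm.abs.comp measurable_snd).mul hkm
    exact (hJ.stronglyMeasurable.integral_prod_right' (ν := configMeasure SU2 1)).measurable
  have hA'b : ∀ u', |A' u'| ≤ Cφ * Ck := fun u' => by
    rw [abs_of_nonneg (hA'0 u')]
    calc A' u' ≤ ∫ u, Cφ * Ck ∂configMeasure SU2 1 :=
          integral_mono_of_nonneg (ae_of_all _ fun u => mul_nonneg (abs_nonneg _) (hk0 _ _)) (integrable_const _)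
            (ae_of_all _ fun u => mul_le_mul (hCφ u) ((le_abs_self _).trans (hCk _ _)) (hk0 _ _) hCφ0)
      _ = Cφ * Ck := by rw [integral_const, smul_eq_mul, probReal_univ, one_mul]
  have hN2m : Measurable N2 := by
    have hJ : Measurable fun p : GaugeConfig 3 1 SU2 × (Edge 3 L → Fin 3 → ℝ) => g (orthoTube L p.1 p.2) ^ 2 * w (orthoTube L p.1 p.2) :=
      ((measurable_comp_orthoTube hgm).pow_const 2).mul (measurable_comp_orthoTube hwm)
    exact (hJ.stronglyMeasurable.integral_prod_right' (ν := orthoTransverse L)).measurable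
  have hN2b : ∀ u', |N2 u'| ≤ Cg ^ 2 * Cw * P := fun u' => by
    rw [abs_of_nonneg (hN20 u')]
    calc N2 u' ≤ ∫ v', Cg ^ 2 * Cw ∂orthoTransverse L :=
          integral_mono_of_nonneg (ae_of_all _ fun v' => mul_nonneg (sq_nonneg _) (hw0 _)) (integrable_const _)
            (ae_of_all _ fun v' => mul_le_mul (by rw [← sq_abs]; exact pow_le_pow_left₀ (abs_nonneg _) (hCg _) 2)
              ((le_abs_self _).trans (hCw _)) (hw0 _) (sq_nonneg _))
      _ = Cg ^ 2 * Cw * P := by rw [integral_const, smul_eq_mul, hPdef, Measure.real]; ring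
  have hSm : Measurable fun u' => Real.sqrt (N2 u') := hN2m.sqrt
  have hSb : ∀ u', |Real.sqrt (N2 u')| ≤ Real.sqrt (Cg ^ 2 * Cw * P) := fun u' => by
    rw [abs_of_nonneg (Real.sqrt_nonneg _)]; exact Real.sqrt_le_sqrt ((le_abs_self _).trans (hN2b u'))
  have hI1 : Integrable (fun u' => A' u' * B u') (configMeasure SU2 1) := by
    have hBm : Measurable B := by
      have hJ : Measurable fun p : GaugeConfig 3 1 SU2 × (Edge 3 L → Fin 3 → ℝ) => |g (orthoTube L p.1 p.2)| * (Ω (linkEmbed L p.2) * w (orthoTube L p.1 p.2)) :=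
        (measurable_comp_orthoTube hgm).abs.mul ((hΩm.comp ((measurable_linkEmbed L).comp measurable_snd)).mul (measurable_comp_orthoTube hwm))
      exact (hJ.stronglyMeasurable.integral_prod_right' (ν := orthoTransverse L)).measurable
    have hBb : ∀ u', |B u'| ≤ Real.sqrt γp * Real.sqrt (Cg ^ 2 * Cw * P) := fun u' => by
      rw [abs_of_nonneg (hB0 u')]
      exact (hBle u').trans (mul_le_mul_of_nonneg_left ((le_abs_self _).trans (hSb u')) (Real.sqrt_nonneg _))
    exact integrable_of_measurable_abs_le _ (hA'm.mul hBm) (C := Cφ * Ck * (Real.sqrt γp * Real.sqrt (Cg ^ 2 * Cw * P))) fun u' => by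
      rw [abs_mul]; exact mul_le_mul (hA'b u') (hBb u') (abs_nonneg _) (by positivity)
  have hI2 : Integrable (fun u' => A' u' * Real.sqrt (N2 u')) (configMeasure SU2 1) :=
    integrable_of_measurable_abs_le _ (hA'm.mul hSm) (C := Cφ * Ck * Real.sqrt (Cg ^ 2 * Cw * P)) fun u' => by
      rw [abs_mul]; exact mul_le_mul (hA'b u') (hSb u') (abs_nonneg _) (by positivity)
  have hstep2 : ∫ u', A' u' * B u' ∂configMeasure SU2 1 ≤ Real.sqrt γp * ∫ u', A' u' * Real.sqrt (N2 u') ∂configMeasure SU2 1 := by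
    rw [← integral_const_mul]
    refine integral_mono hI1 (hI2.const_mul _) fun u' => ?_
    dsimp only
    calc A' u' * B u' ≤ A' u' * (Real.sqrt γp * Real.sqrt (N2 u')) := mul_le_mul_of_nonneg_left (hBle u') (hA'0 u')
      _ = Real.sqrt γp * (A' u' * Real.sqrt (N2 u')) := by ring
  -- Step 3: slow Cauchy–Schwarz `(∫ A'√N2)² ≤ (∫ (√N2)²)(∫ A'²) = ‖g‖²_w · ∫A'²`
  have hcs2 := R40.sq_integral_mul_le_of_support (configMeasure SU2 1) (p := fun u' => Real.sqrt (N2 u')) (q := A') (ω := fun _ => (1 : ℝ)) (χ := fun _ => (1 : ℝ))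
    hSm hA'm measurable_const measurable_const hSb hA'b (fun _ => by rw [abs_one]) (fun _ => zero_le_one) (fun _ => Or.inr rfl) (fun _ _ => rfl)
  have eN2 : ∫ u', Real.sqrt (N2 u') ^ 2 * (1 : ℝ) ∂configMeasure SU2 1 = tubeNormSq w g := by
    rw [tubeNormSq_eq_integral_fibre hwm hCw hgm hCg hgt]
    exact integral_congr_ae (ae_of_all _ fun u' => by dsimp only; rw [Real.sq_sqrt (hN20 u'), mul_one])
  have eA2 : ∫ u', (1 : ℝ) * A' u' ^ 2 * (1 : ℝ) ∂configMeasure SU2 1 = ∫ u', (∫ u, |φ u| * k u' u ∂configMeasure SU2 1) ^ 2 ∂configMeasure SU2 1 :=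
    integral_congr_ae (ae_of_all _ fun u' => by dsimp only; rw [hA'def]; ring)
  have hstep3 : (∫ u', A' u' * Real.sqrt (N2 u') ∂configMeasure SU2 1) ^ 2 ≤ tubeNormSq w g * (Λ ^ 2 * ∫ u, φ u ^ 2 ∂configMeasure SU2 1) := by
    have h := hcs2
    have e : (fun u' => A' u' * Real.sqrt (N2 u') * (1 : ℝ)) = fun u' => A' u' * Real.sqrt (N2 u') := by funext u'; ring
    rw [e, eN2, eA2] at h
    exact h.trans (mul_le_mul_of_nonneg_left hkop (by unfold tubeNormSq; exact integral_nonneg fun U => mul_nonneg (sq_nonneg _) (hw0 U)))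
  -- Step 4: `γ₋ ∫ φ² ≤ ‖boFun φ Ω‖²_w`
  have hstep4 : γm * ∫ u, φ u ^ 2 ∂configMeasure SU2 1 ≤ tubeNormSq w (boFun L φ Ω) := by
    rw [tubeNormSq_boFun hφm hCφ hΩm hCΩ hwm hCw, ← integral_const_mul]
    have hMm : Measurable (fibreMass L w Ω) := by
      have hJ : Measurable fun p : GaugeConfig 3 1 SU2 × (Edge 3 L → Fin 3 → ℝ) => Ω (linkEmbed L p.2) ^ 2 * w (orthoTube L p.1 p.2) :=
        ((hΩm.comp ((measurable_linkEmbed L).comp measurable_snd)).pow_const 2).mul (measurable_comp_orthoTube hwm)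
      exact (hJ.stronglyMeasurable.integral_prod_right' (ν := orthoTransverse L)).measurable
    have hMb : ∀ u, |fibreMass L w Ω u| ≤ γp := fun u => by
      have h0 : 0 ≤ fibreMass L w Ω u := by unfold fibreMass; exact integral_nonneg fun v => mul_nonneg (sq_nonneg _) (hw0 _)
      rw [abs_of_nonneg h0]; exact hNp u
    refine integral_mono ((integrable_of_measurable_abs_le _ (hφm.pow_const 2) (C := Cφ ^ 2) fun u => by
        rw [abs_pow]; exact pow_le_pow_left₀ (abs_nonneg _) (hCφ u) 2).const_mul γm)
      (integrable_of_measurable_abs_le _ ((hφm.pow_const 2).mul hMm) (C := Cφ ^ 2 * γp) fun u => by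
        rw [abs_mul, abs_pow]; exact mul_le_mul (pow_le_pow_left₀ (abs_nonneg _) (hCφ u) 2) (hMb u) (abs_nonneg _) (sq_nonneg _)) fun u => ?_
    dsimp only
    by_cases hφ : φ u = 0
    · rw [hφ]; simp
    · rw [mul_comm]; exact mul_le_mul_of_nonneg_left (hNm u hφ) (sq_nonneg _)
  -- Step 5: assemble
  have hTg0 : 0 ≤ tubeNormSq w g := by unfold tubeNormSq; exact integral_nonneg fun U => mul_nonneg (sq_nonneg _) (hw0 U)
  have hTf0 : 0 ≤ tubeNormSq w (boFun L φ Ω) := by unfold tubeNormSq; exact integral_nonneg fun U => mul_nonneg (sq_nonneg _) (hw0 U)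
  have hI0 : 0 ≤ ∫ u', A' u' * Real.sqrt (N2 u') ∂configMeasure SU2 1 := integral_nonneg fun u' => mul_nonneg (hA'0 u') (Real.sqrt_nonneg _)
  have hφ2 : ∫ u, φ u ^ 2 ∂configMeasure SU2 1 ≤ tubeNormSq w (boFun L φ Ω) / γm := by
    rw [le_div_iff₀ hγm, mul_comm]; exact hstep4
  have hM0 : 0 ≤ Λ * Real.sqrt (tubeNormSq w (boFun L φ Ω) / γm) * Real.sqrt (tubeNormSq w g) := by positivity
  have h5 : ∫ u', A' u' * Real.sqrt (N2 u') ∂configMeasure SU2 1 ≤ Λ * Real.sqrt (tubeNormSq w (boFun L φ Ω) / γm) * Real.sqrt (tubeNormSq w g) := by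
    have hsq : (∫ u', A' u' * Real.sqrt (N2 u') ∂configMeasure SU2 1) ^ 2 ≤ (Λ * Real.sqrt (tubeNormSq w (boFun L φ Ω) / γm) * Real.sqrt (tubeNormSq w g)) ^ 2 := by
      have e : (Λ * Real.sqrt (tubeNormSq w (boFun L φ Ω) / γm) * Real.sqrt (tubeNormSq w g)) ^ 2 = tubeNormSq w g * (Λ ^ 2 * (tubeNormSq w (boFun L φ Ω) / γm)) := by
        rw [mul_pow, mul_pow, Real.sq_sqrt hTg0, Real.sq_sqrt (div_nonneg hTf0 hγm.le)]; ring
      rw [e]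
      exact hstep3.trans (mul_le_mul_of_nonneg_left (mul_le_mul_of_nonneg_left hφ2 (sq_nonneg _)) hTg0)
    exact le_of_pow_le_pow_left₀ two_ne_zero hM0 hsq
  have e2 : Real.sqrt γp * Real.sqrt (tubeNormSq w (boFun L φ Ω) / γm) = Real.sqrt (γp / γm) * Real.sqrt (tubeNormSq w (boFun L φ Ω)) := by
    rw [← Real.sqrt_mul hγp, ← Real.sqrt_mul (div_nonneg hγp hγm.le)]
    congr 1; field_simp
  calc |tubeCross β g (boFun L φ Ω)| ≤ η * ∫ u', A' u' * B u' ∂configMeasure SU2 1 := hdoor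
    _ ≤ η * (Real.sqrt γp * ∫ u', A' u' * Real.sqrt (N2 u') ∂configMeasure SU2 1) := mul_le_mul_of_nonneg_left hstep2 hη
    _ ≤ η * (Real.sqrt γp * (Λ * Real.sqrt (tubeNormSq w (boFun L φ Ω) / γm) * Real.sqrt (tubeNormSq w g))) :=
        mul_le_mul_of_nonneg_left (mul_le_mul_of_nonneg_left h5 (Real.sqrt_nonneg _)) hη
    _ = η * Λ * (Real.sqrt γp * Real.sqrt (tubeNormSq w (boFun L φ Ω) / γm)) * Real.sqrt (tubeNormSq w g) := by ring
    _ = η * Λ * Real.sqrt (γp / γm) * Real.sqrt (tubeNormSq w (boFun L φ Ω)) * Real.sqrt (tubeNormSq w g) := by rw [e2]; ring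

end Summit.QuantumFields.YangMills.Theorems.FemtoTransferGap.TwoLattice.ConstTube

end
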